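import Literature.Geometry.Riemannian.CyclicCoverOrbitSpace
import Mathlib.MeasureTheory.Constructions.BorelSpace.Basic
import Mathlib.Topology.EMetricSpace.Lipschitz
import HarnessLib

/-!
# The time-slices `(M, d_g)` of a compact Riemannian manifold as complete separable metric
measure spaces (the slices of the metric flow of a Ricci flow, Bamler 2023, Def. 3.2)

Bamler 2023, §3.1, Def. 3.2 (the tree's `Literature.Geometry.Riemannian.MetricFlow`) asks every
time-slice of a metric flow to be a **complete separable metric space** `(𝒳_t, d_t)` carrying its
Borel σ-algebra, and formulates the gradient property (item (6)) with `d_t`-Lipschitz functions.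
For the metric flow of a Ricci flow `(M, g(t))` on a compact manifold the slice at time `t` is
`(M, d_{g(t)})`, the Riemannian distance of `g(t)`.

The tree already has, for a Riemannian `PseudoRiemannianMetric` `g` (`hg : g.IsRiemannian`) on a
(pre)connected Hausdorff manifold `M`:

* the Riemannian distance `g.edist hg : M → M → ℝ≥0∞` (`RiemannianDistance.lean`, O'Neill 1983,
  Ch. 5, Def. 15, Prop. 18), finite on connected manifolds (`edist_lt_top`, `edist_ne_top`,
  `CutLocusProofs.lean`);
* its `MetricSpace` packaging `g.metricSpace hg` (`CyclicCoverOrbitSpace.lean`, §1), whose topology is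
  *definitionally* the manifold topology (`metricSpace_topology_eq`, `rfl`) and whose (e)distance
  is `d_g` (`metricSpace_edist`, `metricSpace_dist`).

This file adds the remaining items of Def. 3.2 for `g.metricSpace hg` on a connected `T₃` manifold
(the setting of the time-slices of a compact Ricci flow):

* `metricSpace_completeSpace` — on a compact manifold `(M, d_g)` is complete (a compact uniform
  space is complete);
* `metricSpace_separableSpace` — on a second countable manifold `(M, d_g)` is separable;
* `metricSpace_borelSpace` — a Borel σ-algebra of the manifold topology is the Borel σ-algebra of
  `(M, d_g)` (same topology);
* `metricSpace_lipschitzWith_iff` — `f : M → ℝ` is `K`-Lipschitz for `d_g` iff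
  `|f x - f y| ≤ K d_g(x, y)` for all `x, y` (as extended reals), the form in which the gradient
  property of Def. 3.2 (6) is checked against gradient estimates for the heat equation.

Everything is proved; no definitions and no named facts are introduced.

## References

* R. H. Bamler, *Compactness theory of the space of super Ricci flows*, Invent. Math. 233 (2023)
  1121–1277, §3.1, Def. 3.2 (metric flow: items (3) and (6)). [Bamler2023]
* B. O'Neill, *Semi-Riemannian geometry with applications to relativity*, Academic Press 1983,
  Ch. 5, Def. 15, Prop. 18 (the Riemannian distance is a metric compatible with the topology).
  [ONeill1983]
-/

noncomputable section

open Bundle Set Function Filter Manifold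
open scoped Manifold ContDiff Topology ENNReal NNReal

namespace Literature.Geometry.Riemannian

section MetricSpace
open Literature.Geometry.Lorentzian (PseudoRiemannianMetric)
open Literature.Geometry.Lorentzian.PseudoRiemannianMetric

variable {E : Type*} [NormedAddCommGroup E] [NormedSpace ℝ E] {H : Type*} [TopologicalSpace H]
  {I : ModelWithCorners ℝ E H} {M : Type*} [TopologicalSpace M] [ChartedSpace H M]
  [IsManifold I ∞ M] {n : ℕ∞ω} [FiniteDimensional ℝ E]
  {g : PseudoRiemannianMetric I n E (TangentSpace I : M → Type _)}

/-- **On a compact connected Riemannian manifold `(M, d_g)` is complete** (Bamler 2023, Def. 3.2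
(3), for the time-slices of a compact Ricci flow): the uniform structure of `g.metricSpace hg` has
the manifold topology, which is compact, and a compact uniform space is complete
(`complete_of_compact`). [folklore] -/
theorem _root_.Literature.Geometry.Lorentzian.PseudoRiemannianMetric.metricSpace_completeSpace
    [T3Space M] [ConnectedSpace M] [CompactSpace M] (hg : g.IsRiemannian) :
    @CompleteSpace M (g.metricSpace hg).toUniformSpace := by
  letI := g.metricSpace hg
  infer_instance

/-- **On a second countable connected Riemannian manifold `(M, d_g)` is separable** (Bamler 2023,
Def. 3.2 (3)): the topology of `g.metricSpace hg` is the manifold topology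
(`metricSpace_topology_eq`), and a second countable space is separable. [folklore] -/
theorem _root_.Literature.Geometry.Lorentzian.PseudoRiemannianMetric.metricSpace_separableSpace
    [T3Space M] [ConnectedSpace M] [SecondCountableTopology M] (hg : g.IsRiemannian) :
    @TopologicalSpace.SeparableSpace M (g.metricSpace hg).toUniformSpace.toTopologicalSpace := by
  rw [metricSpace_topology_eq hg]
  infer_instance

/-- **The Borel σ-algebra of the manifold is the Borel σ-algebra of `(M, d_g)`** (Bamler 2023,
Def. 3.2: the slices carry the Borel σ-algebra of `d_t`): the two topologies agree
definitionally (`metricSpace_topology_eq`). [folklore] -/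
theorem _root_.Literature.Geometry.Lorentzian.PseudoRiemannianMetric.metricSpace_borelSpace
    [T3Space M] [ConnectedSpace M] [MeasurableSpace M] [BorelSpace M] (hg : g.IsRiemannian) :
    @BorelSpace M (g.metricSpace hg).toUniformSpace.toTopologicalSpace ‹MeasurableSpace M› :=
  ‹BorelSpace M›

/-- **Lipschitz functions for the Riemannian distance**: a function `f : M → ℝ` is `K`-Lipschitz
for the metric space `(M, d_g)` iff `|f x - f y| ≤ K · d_g(x, y)` for all `x, y` (in `ℝ≥0∞`;
`edist (f x) (f y) = ENNReal.ofReal |f x - f y|` on `ℝ` and `edist x y = d_g(x, y)` on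
`g.metricSpace hg`, `metricSpace_edist`) — the form of the Lipschitz conditions in the gradient
property of Bamler 2023, Def. 3.2 (6). [folklore] -/
theorem _root_.Literature.Geometry.Lorentzian.PseudoRiemannianMetric.metricSpace_lipschitzWith_iff
    [T3Space M] [ConnectedSpace M] (hg : g.IsRiemannian) (K : ℝ≥0) (f : M → ℝ) :
    @LipschitzWith M ℝ (g.metricSpace hg).toPseudoMetricSpace.toPseudoEMetricSpace _ K f ↔
      ∀ x y, ENNReal.ofReal |f x - f y| ≤ K * g.edist hg x y := by
  letI := g.metricSpace hg
  refine forall₂_congr fun x y ↦ ?_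
  rw [edist_dist (f x) (f y), Real.dist_eq, metricSpace_edist hg x y]

end MetricSpace

end Literature.Geometry.Riemannian
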